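import Summits.BirchSwinnertonDyer.BirchSwinnertonDyer.Theorems.PrintCFramBottomClassIndexLawFiveLeHerbrandEigenspaceProjectors
import HarnessLib

/-!
# Route `PrintCFram`, crux C2 `BottomClassIndexLawFiveLe` (stmt-BirchSwinnertonDyer-20372), line
# `eisenstein-resource-bdp-line` v10, Stub H `stub_bottomResidualSelmer_trivial_of_bernoulliPair`, typing item T3 of
# `Lines/herbrand-regular-locus-M1-anatomy.md` §8, part 5: THE NORM–INCLUSION LEMMA — `χ`-parts upstairs and downstairs agree
# when `χ` is trivial on `H` and `|H| ∈ kˣ` (anatomy §5: `(Cl_L ⊗ ℤ_p)^{(χ)} ≅ (Cl_{F_χ} ⊗ ℤ_p)^{(χ)}`,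
# `U^1_p(L)^{(χ)} ≅ U^1_p(F_χ)^{(χ)}` for `F_χ = L^{ker χ}`, `p ∤ [L : F_χ]`)
# (cell `bsd-print-cfram`, seat `bsd-line-cfram-p1-w4` g4; helper `--supports` 20372; 0 facts, 0 defs)

HONEST FRAMING. Nothing about BSD is proved here. Pure algebra continuing `…HerbrandEigenspaceProjectors` (the `χ`-part
`V^{(χ)} = ⨅ g, eigenspace (ρ g) (χ g)`, written out). The situation of anatomy §5: a `G`-module `X` "upstairs" (class
group / semi-local units of `L`), a `G`-module `Y` "downstairs" (the same for the subfield `F = L^H`), equivariant maps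
`i : Y → X` (inclusion / extension of ideals) and `N : X → Y` (norm) with `i ∘ N = Σ_{h ∈ H} h` and `N ∘ i = |H|`, and a
character `χ` of `G` TRIVIAL on `H` (so `F ⊇ F_χ`):
* `iInf_eigenspace_le_invariants_of_forall_eq_one` — `X^{(χ)} ≤ X^H` (no finiteness);
* `sum_apply_eq_card_smul_of_mem` — `(Σ_h ρ h) x = |H| • x` on `X^{(χ)}`, hence `i (N x) = |H| • x`
  (`comp_apply_eq_card_smul_of_mem`);
* with `|H| ∈ kˣ`: **`map_iInf_eigenspace_eq_of_norm`** (`i(Y^{(χ)}) = X^{(χ)}`), **`injOn_iInf_eigenspace_of_norm`** (`i` is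
  injective on `Y^{(χ)}`), `map_norm_iInf_eigenspace_eq` (`N(X^{(χ)}) = Y^{(χ)}`), `norm_injOn_iInf_eigenspace`, and
  **`iInf_eigenspace_eq_bot_iff_of_norm`** (`X^{(χ)} = 0 ↔ Y^{(χ)} = 0`) — "norm/inclusion give
  `(Cl_L ⊗ ℤ_p)^{(χ)} ≅ (Cl_{F_χ} ⊗ ℤ_p)^{(χ)}` (`i ∘ N = Σ_{g ∈ Gal(L/F_χ)} g` acts as `[L : F_χ]` on `χ`-parts)".
No domain hypothesis; `X`, `Y` arbitrary (torsion allowed).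

THEOREMS ONLY; no definition, no named fact, no `sorry`; imports no `Theses` module. BSD is not proved by any of
this; no summit statement is proved by this seat.
References: [Washington1997] §6.3, §10.2 (norm arguments on `χ`-components); [Lang1990] Ch. 1 §3, Ch. 3 §4.
-/

set_option autoImplicit false
-- `…BirchSwinnertonDyer.BirchSwinnertonDyer.Theorems…` is the problem's mandated namespace (D-0017).
set_option linter.dupNamespace false

namespace Summit.BirchSwinnertonDyer.BirchSwinnertonDyer.Theorems.PrintCFram.HerbrandEigenspace

open Module Module.End Representation

section Norm

variable {k G X Y : Type*} [CommRing k] [Group G] [AddCommGroup X] [Module k X] [AddCommGroup Y] [Module k Y]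
  (ρ : Representation k G X) (σ : Representation k G Y) (χ : G →* kˣ) (H : Subgroup G)

/-- If `χ` is trivial on `H` then the `χ`-part is fixed by `H`: `X^{(χ)} ≤ X^H` (Mathlib `invariants` of `ρ|_H`). [folklore] -/
theorem iInf_eigenspace_le_invariants_of_forall_eq_one (hχ : ∀ h : H, χ (h : G) = 1) :
    (⨅ g : G, eigenspace (ρ g) (χ g : k)) ≤ Representation.invariants (ρ.comp H.subtype) := by
  intro x hx
  rw [mem_iInf_eigenspace_iff] at hx
  rw [Representation.mem_invariants]
  intro h
  rw [MonoidHom.comp_apply, Subgroup.subtype_apply, hx, hχ h, Units.val_one, one_smul]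

variable [Fintype H]

/-- On `X^{(χ)}`, `χ` trivial on `H`: `(Σ_{h ∈ H} ρ h) x = |H| • x`. [folklore] -/
theorem sum_apply_eq_card_smul_of_mem (hχ : ∀ h : H, χ (h : G) = 1) {x : X}
    (hx : x ∈ ⨅ g : G, eigenspace (ρ g) (χ g : k)) : (∑ h : H, ρ (h : G)) x = (Fintype.card H : k) • x := by
  rw [mem_iInf_eigenspace_iff] at hx
  have h1 : ∀ h : H, ρ (h : G) x = x := fun h => by rw [hx, hχ h, Units.val_one, one_smul]
  simp only [LinearMap.sum_apply, h1, Finset.sum_const, Finset.card_univ, Nat.cast_smul_eq_nsmul]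

variable (i : Y →ₗ[k] X) (N : X →ₗ[k] Y) (hi : ∀ g : G, i ∘ₗ σ g = ρ g ∘ₗ i) (hN : ∀ g : G, N ∘ₗ ρ g = σ g ∘ₗ N)
  (hiN : i ∘ₗ N = ∑ h : H, ρ (h : G)) (hNi : N ∘ₗ i = (Fintype.card H : k) • LinearMap.id)

include hiN in
/-- **`i (N x) = |H| • x` on `X^{(χ)}`** (`i ∘ N = Σ_{h ∈ H} h`, `χ|_H = 1`). [cite: Washington1997, §10.2] [folklore] -/
theorem comp_apply_eq_card_smul_of_mem (hχ : ∀ h : H, χ (h : G) = 1) {x : X}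
    (hx : x ∈ ⨅ g : G, eigenspace (ρ g) (χ g : k)) : i (N x) = (Fintype.card H : k) • x := by
  rw [← LinearMap.comp_apply, hiN, sum_apply_eq_card_smul_of_mem ρ χ H hχ hx]

include hN in
/-- The norm maps `X^{(χ)}` into `Y^{(χ)}`. [folklore] -/
theorem norm_apply_mem {x : X} (hx : x ∈ ⨅ g : G, eigenspace (ρ g) (χ g : k)) :
    N x ∈ ⨅ g : G, eigenspace (σ g) (χ g : k) :=
  map_iInf_eigenspace_le ρ σ χ N hN (Submodule.mem_map_of_mem hx)

include hi in
/-- The inclusion maps `Y^{(χ)}` into `X^{(χ)}`. [folklore] -/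
theorem incl_apply_mem {y : Y} (hy : y ∈ ⨅ g : G, eigenspace (σ g) (χ g : k)) :
    i y ∈ ⨅ g : G, eigenspace (ρ g) (χ g : k) :=
  map_iInf_eigenspace_le σ ρ χ i hi (Submodule.mem_map_of_mem hy)

variable [Invertible (Fintype.card H : k)]

include hi hN hiN in
/-- **Norm–inclusion, image form: `i(Y^{(χ)}) = X^{(χ)}`** for `χ|_H = 1` and `|H| ∈ kˣ` (`x = i(⅟|H| • N x)`).
[cite: Washington1997, §10.2] [folklore] -/
theorem map_iInf_eigenspace_eq_of_norm (hχ : ∀ h : H, χ (h : G) = 1) :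
    (⨅ g : G, eigenspace (σ g) (χ g : k)).map i = ⨅ g : G, eigenspace (ρ g) (χ g : k) := by
  refine le_antisymm (map_iInf_eigenspace_le σ ρ χ i hi) fun x hx => ?_
  refine Submodule.mem_map.mpr ⟨⅟(Fintype.card H : k) • N x, Submodule.smul_mem _ _ (norm_apply_mem ρ σ χ N hN hx), ?_⟩
  rw [map_smul, comp_apply_eq_card_smul_of_mem ρ χ H i N hiN hχ hx, smul_smul, invOf_mul_self, one_smul]

include hNi in
/-- **Norm–inclusion, kernel form: `i` is injective on `Y`** when `N ∘ i = |H| ∈ kˣ` (in particular on `Y^{(χ)}`). [folklore] -/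
theorem incl_injective_of_norm : Function.Injective i := by
  intro y y' h
  have e : N (i y) = N (i y') := by rw [h]
  rw [← LinearMap.comp_apply, ← LinearMap.comp_apply, hNi, LinearMap.smul_apply, LinearMap.smul_apply,
    LinearMap.id_apply, LinearMap.id_apply] at e
  simpa [smul_smul, invOf_mul_self] using congrArg (fun z => ⅟(Fintype.card H : k) • z) e

include hi hN hNi in
/-- **`N(X^{(χ)}) = Y^{(χ)}`** for `|H| ∈ kˣ` and `N ∘ i = |H|`: `y = N(⅟|H| • i y)` with `i y ∈ X^{(χ)}`; the inclusion
`N(X^{(χ)}) ≤ Y^{(χ)}` is `norm_apply_mem`. [folklore] -/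
theorem map_norm_iInf_eigenspace_eq :
    (⨅ g : G, eigenspace (ρ g) (χ g : k)).map N = ⨅ g : G, eigenspace (σ g) (χ g : k) := by
  refine le_antisymm (map_iInf_eigenspace_le ρ σ χ N hN) fun y hy => ?_
  refine Submodule.mem_map.mpr ⟨⅟(Fintype.card H : k) • i y, Submodule.smul_mem _ _ (incl_apply_mem ρ σ χ i hi hy), ?_⟩
  rw [map_smul, ← LinearMap.comp_apply, hNi, LinearMap.smul_apply, LinearMap.id_apply, smul_smul, invOf_mul_self,
    one_smul]

include hiN in
/-- `N` is injective on `X^{(χ)}` (`χ|_H = 1`, `|H| ∈ kˣ`): `N x = 0 ⟹ |H| • x = i (N x) = 0`. [folklore] -/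
theorem norm_injOn_iInf_eigenspace (hχ : ∀ h : H, χ (h : G) = 1) :
    Set.InjOn N (⨅ g : G, eigenspace (ρ g) (χ g : k) : Submodule k X) := by
  intro x hx x' hx' h
  have e := comp_apply_eq_card_smul_of_mem ρ χ H i N hiN hχ (Submodule.sub_mem _ hx hx')
  rw [map_sub, h, sub_self, map_zero] at e
  have e' := congrArg (fun z => ⅟(Fintype.card H : k) • z) e
  simp only [smul_zero, smul_smul, invOf_mul_self, one_smul] at e'
  exact sub_eq_zero.mp e'.symm

include hi hN hiN hNi in
/-- **`X^{(χ)} = 0 ↔ Y^{(χ)} = 0`** for `χ|_H = 1`, `|H| ∈ kˣ`: the `χ`-parts upstairs and downstairs vanish together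
(anatomy §5: `(Cl_L ⊗ ℤ_p)^{(χ)} = 0 ↔ (Cl_{F_χ} ⊗ ℤ_p)^{(χ)} = 0`). [cite: Washington1997, §10.2] [folklore] -/
theorem iInf_eigenspace_eq_bot_iff_of_norm (hχ : ∀ h : H, χ (h : G) = 1) :
    (⨅ g : G, eigenspace (ρ g) (χ g : k)) = ⊥ ↔ (⨅ g : G, eigenspace (σ g) (χ g : k)) = ⊥ := by
  constructor
  · intro h
    refine (Submodule.eq_bot_iff _).mpr fun y hy => incl_injective_of_norm H i N hNi ?_
    have := incl_apply_mem ρ σ χ i hi hy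
    rw [h] at this
    rw [(Submodule.mem_bot k).mp this, map_zero]
  · intro h
    rw [← map_iInf_eigenspace_eq_of_norm ρ σ χ H i N hi hN hiN hχ, h, Submodule.map_bot]

end Norm

end Summit.BirchSwinnertonDyer.BirchSwinnertonDyer.Theorems.PrintCFram.HerbrandEigenspace
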